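import Literature.MathematicalPhysics.QuantumFieldTheory.Balaban1983to89.B15Prop1GaugeLetterGammaZeroPin
import Literature.MathematicalPhysics.QuantumFieldTheory.Balaban1983to89.B15Prop1InteriorLetterSameRoot
import Literature.MathematicalPhysics.QuantumFieldTheory.Balaban1983to89.B15Prop1InteriorLetterCorridor
import Literature.MathematicalPhysics.QuantumFieldTheory.Balaban1983to89.B5Eq118OneStroke

/-!
# `Balaban1983to89.B15Prop1GaugeLetterLocOfForestPackage` — [Balaban1985Variational] = «[15]», (4) p. 278, (16)–(18) p. 280 ∕ [Balaban1985RegularSpaces] = «[6]», (1.19) p. 79 ∕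
# [Balaban1988Convergent] = «[III]», (2.2) p. 255, (2.13) pp. 256–257: THE LOCALISED GAUGE LETTER (σ)_N AT THE ENDPOINT's OBJECTS FROM THE ROOTED TOWER FOREST PACKAGE, ONE
# ROOT-FREE PLAQUETTE LETTER AND THE ROOT-TRANSPORTER LETTER — the assembled producer of the N12∕s1 lane's gauge letter after the lane ruling (R-a)

statement-level skeleton of published theorems with citation tags; proofs where landed; nothing here is a claim about the Yang–Mills mass gap

WHY (cell `pub-ymgap`, HUMAN RULINGS D-0062 ∕ D-0149 ∕ D-0154, width seat `pub-ymgap-dag-n12-w6` g2; node N12 = [B15]; count-neutral helper).  The producer of the localised gauge letter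
(`B15Prop1GaugeLetterGammaZeroPin.exists_gaugeLetterLoc_atRecord`) displays the interior letter `hL`; `B15Prop1InteriorLetterSameRoot` ∕ `B15Prop1InteriorLetterCorridor` split it into a
same-root half (discharged from one plaquette letter on boxes around the ROOTS) and a two-root half (reduced to a root-transporter letter `hT`).  The forest enters all three through the
clauses of dag-n12-w3's ROOTED TOWER FOREST of `𝐁_k(Z)` (`Summits/…/BalabanUVNodesN12TowerForestRootsBj.exists_towerForest_rooted_Bj`, p635000: (F2), «every path is the walk of its word
from its root», and per rooted level (LEN) `|path z| ≤ Σ_{i≤j}(d(Lⁱ−1)∕2+1)`, (DISP) the TRUE integer displacement `netDisp (word z) = z − root z`, with (Cov) «every site has a member level»).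
THIS FILE composes everything BY SHAPE (a Literature file cannot import the Summits-side package, so its clauses are hypotheses, verbatim): (§1) from (LEN)+(DISP)+(Cov) the uniform length
bound `ℓ_k` and the displacement identity at EVERY site; (§2) by (DISP) the box of radius `R` around `root z` lies in the box of radius `R + ℓ` around the SITE `z` (`|netDisp| ≤ |word| ≤ ℓ`),
so the plaquette letter may be stated ROOT-FREE — on boxes around SITES of `Ω₁(Z)`; (§3) the plaquette premise is GRADED BY THE BOND (per-site word budgets `ℓs`, per-bond transporter
budgets `ℓb`: the box of radius `2·max (ℓs b₋) (ℓs b₊) + 1 + ℓb b + ℓs b₋` around `b₋`) — as the class (1.7) of the minimiser is graded by the level, near `∂Ω₁` words and chains are short and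
a uniform radius `∼ L^k` would leave the printed collar — with uniform caps `ℓ`, `ℓT` only for the no-wrapping hypothesis and the (crude, uniform) tolerance; then the assembled producer: from
the package clauses, the region-normalised datum, the minimiser, the neighbourhood geometry, the graded root-free plaquette letter `hP` and the root-transporter letter `hT` (inhabited Summits-side
from chains of member-bond segments by dag-n12-w3's `…N12RootTransporterBj`, cell bus 2026-08-28), the letter (σ)_N with tolerance `max ρn (((2ℓ+1+ℓT)²∕4)·εP + eT + dG)`; and a target edition.

CONTENTS (theorems only; no `def`, no `instance`, no `sorry`).
* §1 ★ `length_le_and_netDisp_of_package` — (LEN)+(DISP)+(Cov) ⟹ `|path z| ≤ ℓ_k` and `netDisp (word z) ν = z_ν − (root z)_ν` for every site.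
* §2 ★ `exists_rootBox_of_siteBox` — the root's coordinate box of radius `R` from the site's box of radius `R + ℓ`.
* §3 ★★ `dist1_gaugeAct_holAtGauge_le_graded` (the interior letter, both halves, with the GRADED root-free plaquette premise; any level-`0` forest in word currency, any `GaugeGroup`),
  ★★★ `exists_gaugeLetterLoc_atRecord_of_forestPackage` — (σ)_N at the endpoint's objects from the package clauses + graded `hP` (root-free) + `hT`; ★ `uniform_budget_admissible`
  (`ℓs := ℓ_k` is allowed); ★★ `tolerance_le_of_target` — any target tolerance `δT ≥ ρn + ((2ℓ+1+ℓT)²∕4)·εP + eT + dG`.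

HONEST FRAMING: composition by name and lattice bookkeeping; the forest package, the minimiser ([15] Thm 1), the plaquette letter ((1.7) at the minimiser ∕ [15] Thm 1 (8)), the
root-transporter letter and the geometry of `N` stay HYPOTHESES; nothing of Bałaban's is asserted; count-neutral; N12 NOT discharged; finite 𝕋⁴ at fixed ε; nothing continuum ∕ OS ∕
mass-gap ∕ Clay.
-/

noncomputable section

open scoped Matrix.Norms.L2Operator BigOperators

namespace Literature.MathematicalPhysics.QuantumFieldTheory.Balaban1983to89.B15Prop1GaugeLetterLocOfForestPackage

open T4Continuum GaugeField B15DeterminingSets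
open T4CubeChartGnomonic (SU2)
open B16Sect1Backgrounds (toMS)
open T4AxialGaugeSmallField (castSite castSite_apply boxPlaqs)
open B14.Eq213DetSet (Bj maxDomT)
open B14.Eq216Concrete (inputs)
open B14.Eq22Determines (blockIter)
open B5Eq118OneStroke (iterBlockOf)
open Literature.MathematicalPhysics.QuantumFieldTheory.BalabanImbrieJaffe1984to88.BIJ85Eq453GaugeField (qsstarGIter0)
open LatticeWordCountBox (netDisp_le_count_true neg_count_false_le_netDisp)
open B15Prop1GaugeLetterGammaZeroPin (exists_gaugeLetterLoc_atRecord)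

variable {P : Params}

/-! ## §1  From the package: the uniform length bound and the displacement identity at every site -/

section Package

/-- ★ **(LEN) + (DISP) + (Cov) ⟹ A UNIFORM LENGTH BOUND AND THE DISPLACEMENT IDENTITY AT EVERY SITE.**  The rooted tower forest package of `𝐁_k(Z)` (dag-n12-w3's
`exists_towerForest_rooted_Bj`, clauses by shape) gives, at every rooted level `j ≤ k` of a site `z` (`ι_j(B^j z) ∈ R(𝐁_k(Z), k)`), `|path z| ≤ Σ_{i≤j}(d(Lⁱ−1)∕2 + 1)` and
`netDisp (word z) ν = z_ν − (root z)_ν`; (Cov) every site has a member level `J ≤ k` — and the centre of a member block is a root point (it is an end of the member bond `⟨B^J z, e₀⟩`).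
So EVERY site has `|path z| ≤ ℓ_k := Σ_{i≤k}(d(Lⁱ−1)∕2 + 1)` and the displacement identity. [cite: Balaban1988Convergent, (2.2) p.255, (2.13) pp.256–257; Balaban1985RegularSpaces, (1.19) p.79 (bookkeeping)] -/
theorem length_le_and_netDisp_of_package (M₁ : ℕ) (Z : Set (Site P 0)) (k : ℕ)
    (path : Site P 0 → List (LStep P 0)) (root : Site P 0 → Site P 0)
    (hpkg : ∀ (z : Site P 0) (j : ℕ), j ≤ k →
      embIter j (iterBlockOf j z) ∈ {z : Site P 0 | ∃ j, j ≤ k ∧ ∃ c ∈ bondsOf ((Bj M₁ Z k : DetSet P) j), (z = embIter j c.src ∨ z = embIter j c.tgt)} →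
      (∀ s ∈ path z, iterBlockOf j s.bond.src = iterBlockOf j z ∧ iterBlockOf j s.bond.tgt = iterBlockOf j z) ∧
      (path z).length ≤ ∑ i ∈ Finset.range (j + 1), (P.d * ((P.L ^ i - 1) / 2) + 1) ∧
      (∀ ν, netDisp ((path z).map fun s => (s.bond.dir, s.fwd)) ν = ((z ν).val : ℤ) - ((root z ν).val : ℤ)) ∧
      iterBlockOf j (root z) = iterBlockOf j z)
    (hcov : ∀ z : Site P 0, ∃ J, J ≤ k ∧ iterBlockOf J z ∈ (Bj M₁ Z k : DetSet P) J) (z : Site P 0) :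
    (path z).length ≤ ∑ i ∈ Finset.range (k + 1), (P.d * ((P.L ^ i - 1) / 2) + 1) ∧
      ∀ ν, netDisp ((path z).map fun s => (s.bond.dir, s.fwd)) ν = ((z ν).val : ℤ) - ((root z ν).val : ℤ) := by
  obtain ⟨J, hJ, hz⟩ := hcov z
  have hR : embIter J (iterBlockOf J z) ∈
      {z : Site P 0 | ∃ j, j ≤ k ∧ ∃ c ∈ bondsOf ((Bj M₁ Z k : DetSet P) j), (z = embIter j c.src ∨ z = embIter j c.tgt)} :=
    ⟨J, hJ, ⟨iterBlockOf J z, ⟨0, P.hd⟩⟩, Or.inl hz, Or.inl rfl⟩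
  obtain ⟨-, hlen, hdisp, -⟩ := hpkg z J hJ hR
  have hsub : Finset.range (J + 1) ⊆ Finset.range (k + 1) := Finset.range_mono (Nat.succ_le_succ hJ)
  exact ⟨hlen.trans (Finset.sum_le_sum_of_subset hsub), hdisp⟩

end Package

/-! ## §2  The root's box from the site's box -/

section Boxes

/-- ★ **THE BOX AROUND THE ROOT LIES IN A BIGGER BOX AROUND THE SITE.**  If the word of `z` has length `≤ ℓ` and the displacement identity `netDisp (word z) ν = z_ν − (root z)_ν` holds (no
wrapping, (DISP)), then the integer point `zr := (labels of root z)` satisfies `castSite zr = root z` and its coordinate box of radius `R` lies in the box of radius `R + ℓ` around the labels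
of `z` (`|netDisp| ≤ |word|`).  So a plaquette letter on the boxes around the SITES of `Ω₁(Z)` gives the root-box premises of `B15Prop1InteriorLetterSameRoot` ∕ `…Corridor`.
[cite: Balaban1985Averaging, (5)–(9) pp.18–19 (lattice bookkeeping); Balaban1985RegularSpaces, (1.19) p.79] -/
theorem exists_rootBox_of_siteBox {j : ℕ} (path : Site P j → List (LStep P j)) (root : Site P j → Site P j) {z : Site P j} {ℓ R : ℕ}
    (hlen : (path z).length ≤ ℓ)
    (hdisp : ∀ ν, netDisp ((path z).map fun s => (s.bond.dir, s.fwd)) ν = ((z ν).val : ℤ) - ((root z ν).val : ℤ))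
    {S : Set (Plaq P j)}
    (hS : (boxPlaqs (fun ν => ((z ν).val : ℤ) - ((R + ℓ : ℕ) : ℤ)) (fun ν => ((z ν).val : ℤ) + ((R + ℓ : ℕ) : ℤ) + 2) : Set (Plaq P j)) ⊆ S) :
    ∃ zr : Fin P.d → ℤ, (castSite zr : Site P j) = root z ∧
      (boxPlaqs (fun ν => zr ν - (R : ℤ)) (fun ν => zr ν + (R : ℤ) + 2) : Set (Plaq P j)) ⊆ S := by
  set w := (path z).map fun s => (s.bond.dir, s.fwd) with hw
  have hwl : w.length ≤ ℓ := by rw [hw, List.length_map]; exact hlen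
  refine ⟨fun ν => ((root z ν).val : ℤ), funext fun ν => by rw [castSite_apply, Int.cast_natCast, ZMod.natCast_zmod_val], ?_⟩
  refine Set.Subset.trans ?_ hS
  rintro p ⟨z', hlo, hhi, hsrc⟩
  refine ⟨z', fun ν => le_trans ?_ (hlo ν), fun ν => (hhi ν).trans ?_, hsrc⟩
  · have h1 := netDisp_le_count_true ν w
    have h2 : ((w.count (ν, true) : ℕ) : ℤ) ≤ w.length := by exact_mod_cast List.count_le_length
    have h3 := hdisp ν
    show ((z ν).val : ℤ) - ((R + ℓ : ℕ) : ℤ) ≤ ((root z ν).val : ℤ) - R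
    push_cast
    linarith
  · have h1 := neg_count_false_le_netDisp ν w
    have h2 : ((w.count (ν, false) : ℕ) : ℤ) ≤ w.length := by exact_mod_cast List.count_le_length
    have h3 := hdisp ν
    show ((root z ν).val : ℤ) + R + 2 ≤ ((z ν).val : ℤ) + ((R + ℓ : ℕ) : ℤ) + 2
    push_cast
    linarith

end Boxes

/-! ## §3  The localised gauge letter from the forest package, a GRADED root-free plaquette letter and the root-transporter letter -/

section Assembled

open B15Prop1InteriorLetterSameRoot (dist1_gaugeAct_holAtGauge_le_of_sameRoot_of_boxPlaqs)
open B15Prop1InteriorLetterCorridor (dist1_gaugeAct_holAtGauge_le_of_transporter_of_boxPlaqs)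

/-- The word of a path has the length of the path. [folklore] -/
private theorem length_word {j : ℕ} (p : List (LStep P j)) : (p.map fun s => (s.bond.dir, s.fwd)).length = p.length :=
  List.length_map _

/-- A coordinate box grows with its radius. [folklore] -/
private theorem boxPlaqs_radius_mono {j : ℕ} (z : Fin P.d → ℤ) {a b : ℤ} (hab : a ≤ b) :
    (boxPlaqs (fun ν => z ν - a) (fun ν => z ν + a + 2) : Set (Plaq P j)) ⊆ boxPlaqs (fun ν => z ν - b) (fun ν => z ν + b + 2) := by
  rintro p ⟨z', hlo, hhi, hsrc⟩
  refine ⟨z', fun ν => le_trans ?_ (hlo ν), fun ν => (hhi ν).trans ?_, hsrc⟩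
  · show z ν - b ≤ z ν - a
    linarith
  · show z ν + a + 2 ≤ z ν + b + 2
    linarith

/-- ★★ **THE INTERIOR LETTER WITH A GRADED, ROOT-FREE PLAQUETTE PREMISE** (any level, any `GaugeGroup`).  Forest in word currency on a site set `Ω` with PER-SITE word-length budgets
`|path x| ≤ ℓs x` and the displacement identity (no wrapping); a root-transporter letter with a PER-BOND length budget `ℓb b` and budgets `eT`, `dG`; uniform caps `ℓs ≤ ℓ`, `ℓb ≤ ℓT` with
`2ℓ + 1 + ℓT <` sites per direction; and ONE plaquette letter `PlaqSmallOn S δ U` whose region contains, for every bond `b` inside `Ω`, the box of radius `R_b + ℓs b₋` around the SOURCE SITE,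
`R_b := 2·max (ℓs b₋) (ℓs b₊) + 1 + ℓb b` — graded by the bond, as the class (1.7) of the minimiser is graded by the level ([15] (2), [6] (1.7)): near `∂Ω₁` the words and chains are short.
THEN every bond inside `Ω` has `dist1 ((U^σ) b) ≤ ((2ℓ+1+ℓT)²∕4)·δ + eT + dG` (same-root bonds: the Stokes term alone; `0 ≤ eT`, `0 ≤ dG`).
[cite: Balaban1985Variational, (2) p.278, (16)–(18) p.280; Balaban1985RegularSpaces, (1.7) p.77, (1.19) p.79; Balaban1985Averaging, (19)–(20) p.21] -/
theorem dist1_gaugeAct_holAtGauge_le_graded {G : Type*} [GaugeGroup G] (U : GaugeField P 0 G) (path : Site P 0 → List (LStep P 0)) (root : Site P 0 → Site P 0)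
    (hwalk : ∀ x, path x = walk (root x) ((path x).map fun s => (s.bond.dir, s.fwd)) ∧
      walkEnd (root x) ((path x).map fun s => (s.bond.dir, s.fwd)) = x)
    (Ω : Set (Site P 0)) (ℓs : Site P 0 → ℕ) (hℓs : ∀ x ∈ Ω, (path x).length ≤ ℓs x)
    (hdisp : ∀ x ∈ Ω, ∀ ν, netDisp ((path x).map fun s => (s.bond.dir, s.fwd)) ν = ((x ν).val : ℤ) - ((root x ν).val : ℤ))
    (ℓb : PBond P 0 → ℕ) {ℓ ℓT : ℕ} (hcapS : ∀ x ∈ Ω, ℓs x ≤ ℓ) (hcapB : ∀ b : PBond P 0, b.src ∈ Ω → b.tgt ∈ Ω → ℓb b ≤ ℓT)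
    (hN : 2 * ℓ + 1 + ℓT < P.sitesPerDir 0)
    {S : Set (Plaq P 0)} {δ : ℝ} (hδ : 0 ≤ δ) (hU : PlaqSmallOn S δ U)
    (hSΩ : ∀ b : PBond P 0, b.src ∈ Ω → b.tgt ∈ Ω →
      (boxPlaqs (fun ν => ((b.src ν).val : ℤ) - (((2 * max (ℓs b.src) (ℓs b.tgt) + 1 + ℓb b) + ℓs b.src : ℕ) : ℤ))
          (fun ν => ((b.src ν).val : ℤ) + (((2 * max (ℓs b.src) (ℓs b.tgt) + 1 + ℓb b) + ℓs b.src : ℕ) : ℤ) + 2) : Set (Plaq P 0)) ⊆ S)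
    {eT dG : ℝ} (heT : 0 ≤ eT) (hdG : 0 ≤ dG)
    (hT : ∀ b : PBond P 0, b.src ∈ Ω → b.tgt ∈ Ω → root b.src ≠ root b.tgt →
      ∃ (Ωw : List (Letter P.d)) (g : G), walkEnd (root b.src) Ωw = root b.tgt ∧ Ωw.length ≤ ℓb b ∧
        dist1 (holAt U (walk (root b.src) Ωw) * g⁻¹) ≤ eT ∧ dist1 g ≤ dG)
    {b : PBond P 0} (hbs : b.src ∈ Ω) (hbt : b.tgt ∈ Ω) :
    dist1 (gaugeAct (fun x => holAt U (path x)) U b) ≤ ((((2 * ℓ + 1 + ℓT : ℕ) : ℝ)) ^ 2 / 4) * δ + eT + dG := by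
  -- the per-bond radii and the root box
  set ℓm := max (ℓs b.src) (ℓs b.tgt) with hℓm
  have hℓm_le : ℓm ≤ ℓ := max_le (hcapS _ hbs) (hcapS _ hbt)
  have hℓb_le : ℓb b ≤ ℓT := hcapB b hbs hbt
  obtain ⟨zr, hzr, hbox⟩ := exists_rootBox_of_siteBox path root (R := 2 * ℓm + 1 + ℓb b) (hℓs _ hbs) (hdisp _ hbs) (hSΩ b hbs hbt)
  -- the uniform cap on the Stokes factor
  have hcap : ∀ {r : ℕ}, r ≤ 2 * ℓ + 1 + ℓT → (((r : ℕ) : ℝ)) ^ 2 / 4 * δ ≤ (((2 * ℓ + 1 + ℓT : ℕ) : ℝ)) ^ 2 / 4 * δ := by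
    intro r hr
    have hcast : ((r : ℕ) : ℝ) ≤ ((2 * ℓ + 1 + ℓT : ℕ) : ℝ) := by exact_mod_cast hr
    have h0 : (0 : ℝ) ≤ ((r : ℕ) : ℝ) := by positivity
    exact mul_le_mul_of_nonneg_right (div_le_div_of_nonneg_right (pow_le_pow_left₀ h0 hcast 2) (by norm_num)) hδ
  obtain ⟨s, μ⟩ := b
  have htgt : (PBond.tgt ⟨s, μ⟩ : Site P 0) = s.shift μ := rfl
  simp only [htgt] at hbt hT hℓm hzr hbox
  obtain ⟨hps, hs⟩ := hwalk s
  obtain ⟨hpt, ht⟩ := hwalk (s.shift μ)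
  have hwm : ((path s).map fun s => (s.bond.dir, s.fwd)).length ≤ ℓm := by
    rw [length_word]; exact (hℓs _ hbs).trans (le_max_left _ _)
  have hwp : ((path (s.shift μ)).map fun s => (s.bond.dir, s.fwd)).length ≤ ℓm := by
    rw [length_word]; exact (hℓs _ hbt).trans (le_max_right _ _)
  by_cases hroot : root s = root (s.shift μ)
  · -- same root: the Stokes term alone, on the box of radius `2ℓm + 1`
    rw [← hroot] at hpt ht
    have hbox' := (boxPlaqs_radius_mono (j := 0) zr (show ((2 * ℓm + 1 : ℕ) : ℤ) ≤ ((2 * ℓm + 1 + ℓb ⟨s, μ⟩ : ℕ) : ℤ) by push_cast; omega)).trans hbox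
    have h := dist1_gaugeAct_holAtGauge_le_of_sameRoot_of_boxPlaqs U path (root s) s μ _ _ hps hpt hs ht hwm hwp (by omega) zr hzr hδ hU hbox'
    have h' := hcap (r := 2 * ℓm + 1) (by omega)
    linarith
  · -- two roots: the MASTER bound with the transporter datum, on the box of radius `2ℓm + 1 + ℓb b`
    obtain ⟨Ωw, g, hΩw, hΩl, hH, hg⟩ := hT ⟨s, μ⟩ hbs hbt hroot
    have h := dist1_gaugeAct_holAtGauge_le_of_transporter_of_boxPlaqs U path (root s) (root (s.shift μ)) Ωw hΩw g hH s μ _ _ hps hpt hs ht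
      hwm hwp hΩl (by omega) zr hzr hδ hU hbox
    have h' := hcap (r := 2 * ℓm + 1 + ℓb ⟨s, μ⟩) (by omega)
    linarith

/-- ★★★ **THE LOCALISED GAUGE LETTER (σ)_N AT THE ENDPOINT's OBJECTS, ASSEMBLED** (graded plaquette premise).  Objects of one instance: averaging `Node00.avOfRecord F 2 Kt`, class
`regMSCoPOfRecord F 2 ν Kt k (maxDomT ν.M₁ Z)`, `𝐁_k(Z) = Bj ν.M₁ Z k` (`0 < k ≤ m + K`); a datum field `Ṽ` (`= ext V_k`) which is `ρn`-near `1` on a normalised `k`-bond region `𝒞` (`0 ≤ ρn`);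
a (2.12) minimiser `U₀`; a bond neighbourhood `N` whose block-crossing `Γ₀`-bonds have `k`-shadows in `𝒞` and which contains the four bonds of every `Ω₁(Z)`-touching plaquette; the
ROOTED TOWER FOREST PACKAGE of `𝐁_k(Z)` by shape (`path`, `root`: (F2), «path = walk of its word from its root, ending at the site», the per-level clause (LEN)∕(DISP), (Cov) — dag-n12-w3's
`exists_towerForest_rooted_Bj`; the knit opens it once); PER-SITE word budgets `ℓs` dominating the path lengths on `Ω₁(Z)` (e.g. `ℓ_{J(x)}` at the `Γ`-level, or §1's uniform `ℓ_k`) and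
PER-BOND transporter budgets `ℓb`, with uniform caps `ℓ`, `ℓT`, `2ℓ + 1 + ℓT <` fine sites per direction; ONE root-free GRADED plaquette letter `PlaqSmallOn S εP U₀` on the boxes of radius
`R_b + ℓs b₋` around the source site of every bond inside `Ω₁(Z)` ((1.7) at the minimiser, graded — [15] (2) ∕ Thm 1 (8)); and the ROOT-TRANSPORTER LETTER with budgets `(ℓb, eT, dG)`
([15] (16)–(18) between the points of `𝔅_k`; dag-n12-w3's `…N12RootTransporterBj`, `ℓb := m·L^k` or graded).  THEN the tower-axial gauge `σ` carries `hu`, C1 and `Cin` on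
`inputs 𝐁_k(Z) ∩ N` with the ONE tolerance `max ρn (((2ℓ+1+ℓT)²∕4)·εP + eT + dG)`. [cite: Balaban1985Variational, (2),(4) p.278, Thm 1 (8) p.279, (16)–(18) p.280; Balaban1985RegularSpaces,
(1.7) p.77, (1.19) p.79; Balaban1988Convergent, (2.2) p.255, (2.11)–(2.13) pp.256–257, (2.16) p.257; Balaban1989LargeFieldI, (1.74) p.192, Prop. 1 p.194] -/
theorem exists_gaugeLetterLoc_atRecord_of_forestPackage {F : T4Family} (ν : Node00.Stage7Numerics) (Kt : ℕ) {k : ℕ} (hk0 : 0 < k)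
    (hk : k ≤ (F.P Kt).m + (F.P Kt).K) (Z : Set (Site (F.P Kt) 0))
    -- the rooted tower forest package, by shape
    (path : Site (F.P Kt) 0 → List (LStep (F.P Kt) 0)) (root : Site (F.P Kt) 0 → Site (F.P Kt) 0)
    (hF2 : ∀ j, j ≤ k → ∀ c ∈ bondsOf (Bj ν.M₁ Z k j), path (embIter j c.src) = [] ∧ path (embIter j c.tgt) = [])
    (hwalk : ∀ x, path x = walk (root x) ((path x).map fun s => (s.bond.dir, s.fwd)) ∧
      walkEnd (root x) ((path x).map fun s => (s.bond.dir, s.fwd)) = x)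
    (hpkg : ∀ (z : Site (F.P Kt) 0) (j : ℕ), j ≤ k →
      embIter j (iterBlockOf j z) ∈ {z : Site (F.P Kt) 0 | ∃ j, j ≤ k ∧ ∃ c ∈ bondsOf ((Bj ν.M₁ Z k : DetSet (F.P Kt)) j), (z = embIter j c.src ∨ z = embIter j c.tgt)} →
      (∀ s ∈ path z, iterBlockOf j s.bond.src = iterBlockOf j z ∧ iterBlockOf j s.bond.tgt = iterBlockOf j z) ∧
      (path z).length ≤ ∑ i ∈ Finset.range (j + 1), ((F.P Kt).d * (((F.P Kt).L ^ i - 1) / 2) + 1) ∧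
      (∀ ν', netDisp ((path z).map fun s => (s.bond.dir, s.fwd)) ν' = ((z ν').val : ℤ) - ((root z ν').val : ℤ)) ∧
      iterBlockOf j (root z) = iterBlockOf j z)
    (hcov : ∀ z : Site (F.P Kt) 0, ∃ J, J ≤ k ∧ iterBlockOf J z ∈ (Bj ν.M₁ Z k : DetSet (F.P Kt)) J)
    -- budgets: per-site word bounds, per-bond transporter bounds, uniform caps (no wrapping)
    (ℓs : Site (F.P Kt) 0 → ℕ) (hℓs : ∀ x ∈ maxDomT ν.M₁ Z 1, (path x).length ≤ ℓs x)
    (ℓb : PBond (F.P Kt) 0 → ℕ) {ℓ ℓT : ℕ} (hcapS : ∀ x ∈ maxDomT ν.M₁ Z 1, ℓs x ≤ ℓ)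
    (hcapB : ∀ b : PBond (F.P Kt) 0, b.src ∈ maxDomT ν.M₁ Z 1 → b.tgt ∈ maxDomT ν.M₁ Z 1 → ℓb b ≤ ℓT) (hN : 2 * ℓ + 1 + ℓT < (F.P Kt).sitesPerDir 0)
    -- the region-normalised datum and the minimiser
    {ρn : ℝ} (hρn : 0 ≤ ρn)
    (W : GaugeField (F.P Kt) k SU2) (𝒞 : Set (PBond (F.P Kt) k)) (hD : ∀ c ∈ 𝒞, dist1 (W c) ≤ ρn)
    {U₀ : GaugeField (F.P Kt) 0 SU2}
    (hmin : IsMinimizer (Node00.avOfRecord F 2 Kt) (Node00.regMSCoPOfRecord F 2 ν Kt k (maxDomT ν.M₁ Z)) (Bj ν.M₁ Z k)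
      (avgFamily (Node00.avOfRecord F 2 Kt) (qsstarGIter0 k W)) U₀)
    -- geometry of the neighbourhood
    (N : Set (PBond (F.P Kt) 0))
    (hGN : ∀ b ∈ N, (b.src ∉ maxDomT ν.M₁ Z 1 ∨ b.tgt ∉ maxDomT ν.M₁ Z 1) → blockIter k b.tgt ≠ blockIter k b.src →
      (⟨blockIter k b.src, b.dir⟩ : PBond (F.P Kt) k) ∈ 𝒞)
    (hN1 : ∀ p : Plaq (F.P Kt) 0, ((⟨p.src, p.μ⟩ : PBond (F.P Kt) 0) ∈ {b : PBond (F.P Kt) 0 | b.src ∈ maxDomT ν.M₁ Z 1} ∨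
        (⟨p.src.shift p.μ, p.ν⟩ : PBond (F.P Kt) 0) ∈ {b : PBond (F.P Kt) 0 | b.src ∈ maxDomT ν.M₁ Z 1} ∨
        (⟨p.src.shift p.ν, p.μ⟩ : PBond (F.P Kt) 0) ∈ {b : PBond (F.P Kt) 0 | b.src ∈ maxDomT ν.M₁ Z 1} ∨
        (⟨p.src, p.ν⟩ : PBond (F.P Kt) 0) ∈ {b : PBond (F.P Kt) 0 | b.src ∈ maxDomT ν.M₁ Z 1}) →
      (⟨p.src, p.μ⟩ : PBond (F.P Kt) 0) ∈ N ∧ (⟨p.src.shift p.μ, p.ν⟩ : PBond (F.P Kt) 0) ∈ N ∧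
        (⟨p.src.shift p.ν, p.μ⟩ : PBond (F.P Kt) 0) ∈ N ∧ (⟨p.src, p.ν⟩ : PBond (F.P Kt) 0) ∈ N)
    -- DISPLAYED: the graded root-free plaquette letter for the minimiser around the bonds of `Ω₁(Z)`
    {S : Set (Plaq (F.P Kt) 0)} {εP : ℝ} (hεP : 0 ≤ εP) (hP : PlaqSmallOn S εP U₀)
    (hSΩ : ∀ b : PBond (F.P Kt) 0, b.src ∈ maxDomT ν.M₁ Z 1 → b.tgt ∈ maxDomT ν.M₁ Z 1 →
      (boxPlaqs (fun κ => ((b.src κ).val : ℤ) - (((2 * max (ℓs b.src) (ℓs b.tgt) + 1 + ℓb b) + ℓs b.src : ℕ) : ℤ))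
          (fun κ => ((b.src κ).val : ℤ) + (((2 * max (ℓs b.src) (ℓs b.tgt) + 1 + ℓb b) + ℓs b.src : ℕ) : ℤ) + 2) : Set (Plaq (F.P Kt) 0)) ⊆ S)
    -- DISPLAYED: the root-transporter letter ([15] (16)–(18) between the points of `𝔅_k`)
    {eT dG : ℝ} (heT : 0 ≤ eT) (hdG : 0 ≤ dG)
    (hT : ∀ b : PBond (F.P Kt) 0, b.src ∈ maxDomT ν.M₁ Z 1 → b.tgt ∈ maxDomT ν.M₁ Z 1 → root b.src ≠ root b.tgt →
      ∃ (Ωw : List (Letter (F.P Kt).d)) (g : SU2), walkEnd (root b.src) Ωw = root b.tgt ∧ Ωw.length ≤ ℓb b ∧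
        dist1 (holAt U₀ (walk (root b.src) Ωw) * g⁻¹) ≤ eT ∧ dist1 g ≤ dG) :
    ∃ σ : GaugeTransf (F.P Kt) 0 SU2,
      (∀ j, j ≤ k → ∀ b ∈ bondsOf (Bj ν.M₁ Z k j), toMS σ j b.src = 1 ∧ toMS σ j b.tgt = 1) ∧
        (∀ p : Plaq (F.P Kt) 0, ((⟨p.src, p.μ⟩ : PBond (F.P Kt) 0) ∈ {b : PBond (F.P Kt) 0 | b.src ∈ maxDomT ν.M₁ Z 1} ∨
            (⟨p.src.shift p.μ, p.ν⟩ : PBond (F.P Kt) 0) ∈ {b : PBond (F.P Kt) 0 | b.src ∈ maxDomT ν.M₁ Z 1} ∨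
            (⟨p.src.shift p.ν, p.μ⟩ : PBond (F.P Kt) 0) ∈ {b : PBond (F.P Kt) 0 | b.src ∈ maxDomT ν.M₁ Z 1} ∨
            (⟨p.src, p.ν⟩ : PBond (F.P Kt) 0) ∈ {b : PBond (F.P Kt) 0 | b.src ∈ maxDomT ν.M₁ Z 1}) →
          ‖((gaugeAct σ U₀ ⟨p.src, p.μ⟩ : SU2) : Matrix (Fin 2) (Fin 2) ℂ) - 1‖ ≤ max ρn ((((2 * ℓ + 1 + ℓT : ℕ) : ℝ)) ^ 2 / 4 * εP + eT + dG) ∧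
            ‖((gaugeAct σ U₀ ⟨p.src.shift p.μ, p.ν⟩ : SU2) : Matrix (Fin 2) (Fin 2) ℂ) - 1‖ ≤ max ρn ((((2 * ℓ + 1 + ℓT : ℕ) : ℝ)) ^ 2 / 4 * εP + eT + dG) ∧
            ‖((gaugeAct σ U₀ ⟨p.src.shift p.ν, p.μ⟩ : SU2) : Matrix (Fin 2) (Fin 2) ℂ) - 1‖ ≤ max ρn ((((2 * ℓ + 1 + ℓT : ℕ) : ℝ)) ^ 2 / 4 * εP + eT + dG) ∧
            ‖((gaugeAct σ U₀ ⟨p.src, p.ν⟩ : SU2) : Matrix (Fin 2) (Fin 2) ℂ) - 1‖ ≤ max ρn ((((2 * ℓ + 1 + ℓT : ℕ) : ℝ)) ^ 2 / 4 * εP + eT + dG)) ∧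
        (∀ b ∈ inputs (Bj ν.M₁ Z k), b ∈ N →
          ‖((gaugeAct σ U₀ b : SU2) : Matrix (Fin 2) (Fin 2) ℂ) - 1‖ ≤ max ρn ((((2 * ℓ + 1 + ℓT : ℕ) : ℝ)) ^ 2 / 4 * εP + eT + dG)) := by
  have hdisp : ∀ x ∈ maxDomT ν.M₁ Z 1, ∀ ν', netDisp ((path x).map fun s => (s.bond.dir, s.fwd)) ν' = ((x ν').val : ℤ) - ((root x ν').val : ℤ) :=
    fun x _ => (length_le_and_netDisp_of_package ν.M₁ Z k path root hpkg hcov x).2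
  have hL : ∀ b : PBond (F.P Kt) 0, b.src ∈ maxDomT ν.M₁ Z 1 → b.tgt ∈ maxDomT ν.M₁ Z 1 →
      ‖((gaugeAct (fun x => holAt U₀ (path x)) U₀ b : SU2) : Matrix (Fin 2) (Fin 2) ℂ) - 1‖ ≤ (((2 * ℓ + 1 + ℓT : ℕ) : ℝ)) ^ 2 / 4 * εP + eT + dG :=
    fun b hbs hbt => dist1_gaugeAct_holAtGauge_le_graded U₀ path root hwalk (maxDomT ν.M₁ Z 1) ℓs hℓs hdisp ℓb hcapS hcapB hN hεP hP hSΩ heT hdG hT hbs hbt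
  exact exists_gaugeLetterLoc_atRecord ν Kt hk0 hk Z path hF2 hρn W 𝒞 hD hmin N hGN hN1 hL

/-- ★ **THE UNIFORM BUDGET `ℓ_k` IS ADMISSIBLE FOR `ℓs`** (§1): the knit may take `ℓs := fun _ => Σ_{i≤k}(d(Lⁱ−1)∕2+1)` — or the sharper `Γ`-level-graded budgets, which keep the plaquette boxes
inside the printed collars. [cite: Balaban1988Convergent, (2.13) pp.256–257 (bookkeeping); Balaban1985RegularSpaces, (1.19) p.79] -/
theorem uniform_budget_admissible {F : T4Family} (ν : Node00.Stage7Numerics) (Kt : ℕ) (k : ℕ) (Z : Set (Site (F.P Kt) 0))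
    (path : Site (F.P Kt) 0 → List (LStep (F.P Kt) 0)) (root : Site (F.P Kt) 0 → Site (F.P Kt) 0)
    (hpkg : ∀ (z : Site (F.P Kt) 0) (j : ℕ), j ≤ k →
      embIter j (iterBlockOf j z) ∈ {z : Site (F.P Kt) 0 | ∃ j, j ≤ k ∧ ∃ c ∈ bondsOf ((Bj ν.M₁ Z k : DetSet (F.P Kt)) j), (z = embIter j c.src ∨ z = embIter j c.tgt)} →
      (∀ s ∈ path z, iterBlockOf j s.bond.src = iterBlockOf j z ∧ iterBlockOf j s.bond.tgt = iterBlockOf j z) ∧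
      (path z).length ≤ ∑ i ∈ Finset.range (j + 1), ((F.P Kt).d * (((F.P Kt).L ^ i - 1) / 2) + 1) ∧
      (∀ ν', netDisp ((path z).map fun s => (s.bond.dir, s.fwd)) ν' = ((z ν').val : ℤ) - ((root z ν').val : ℤ)) ∧
      iterBlockOf j (root z) = iterBlockOf j z)
    (hcov : ∀ z : Site (F.P Kt) 0, ∃ J, J ≤ k ∧ iterBlockOf J z ∈ (Bj ν.M₁ Z k : DetSet (F.P Kt)) J) :
    ∀ x ∈ maxDomT ν.M₁ Z 1, (path x).length ≤ (fun _ : Site (F.P Kt) 0 => ∑ i ∈ Finset.range (k + 1), ((F.P Kt).d * (((F.P Kt).L ^ i - 1) / 2) + 1)) x :=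
  fun x _ => (length_le_and_netDisp_of_package ν.M₁ Z k path root hpkg hcov x).1

/-- ★★ **TARGET EDITION**: any target tolerance `δT ≥ ρn + ((2ℓ+1+ℓT)²∕4)·εP + eT + dG` bounds the assembled tolerance, so the letter of
`exists_gaugeLetterLoc_atRecord_of_forestPackage` holds with both tolerances `δT` — the shape the knit hands to `B15Prop1NumericsThresholds.exists_eR_of_linear_moduli` once `ρn`, `εP`, `eT`,
`dG` are read as linear in the guard. [cite: Balaban1989LargeFieldI, Prop. 1 p.194 («for ε > 0 sufficiently small»); Balaban1985Variational, (4) p.278, (16)–(18) p.280; Balaban1988Convergent, (2.2) p.255, (2.16) p.257] -/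
theorem tolerance_le_of_target {ℓ ℓT : ℕ} {ρn εP eT dG δT : ℝ} (hρn : 0 ≤ ρn) (hεP : 0 ≤ εP) (heT : 0 ≤ eT) (hdG : 0 ≤ dG)
    (hδT : ρn + (((2 * ℓ + 1 + ℓT : ℕ) : ℝ)) ^ 2 / 4 * εP + eT + dG ≤ δT) :
    max ρn ((((2 * ℓ + 1 + ℓT : ℕ) : ℝ)) ^ 2 / 4 * εP + eT + dG) ≤ δT := by
  have hc0 : 0 ≤ (((2 * ℓ + 1 + ℓT : ℕ) : ℝ)) ^ 2 / 4 * εP := by positivity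
  exact max_le (by linarith) (by linarith)

end Assembled

end Literature.MathematicalPhysics.QuantumFieldTheory.Balaban1983to89.B15Prop1GaugeLetterLocOfForestPackage

end
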